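import Mathlib
import Summits.Ventures.PercRepro2.TypedReduce5U
import Summits.Ventures.PercRepro2.TypedUntouchedMarks

/-!
# The reduction spine of row 2′TRI, I: the four-mark base, the pinned-loop rule and the reduction
measure (blind cell PercRepro2, p2 g0, 2026-08-25; sub-claim S1 of `proofs/CRUX-SUBCLAIMS.md`,
section `proofs/subclaims/S1-REDUCTION.md`)

The typed reduction calculus of the cell (`TypedContract.lean` / `TypedReduce5.lean` /
`TypedReduce5U.lean`: contraction of pinned-open edges, the typed root pair, typed loops, unmarked
leaves, pendant `b` / `o`, parallel and series pairs) is closed into one kernel statement in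
`TypedResidual.lean`; this file holds its ingredients:

* **`Base5U4`** — the base of the calculus extended by the two further vanishing rules of
  `TypedUntouchedMarks.lean`: at most five typed edges (`FiveTypedAll`), or one of the four marks
  `a₁, a₂, o, b` has its pinned cluster untouched by the typed edges (the typed base is then `0`);
  `RedM5U4 := RedMGen Base5U4` and `typedCount_nonneg_of_redM5U4` (row 2′TRI on it),
  `redM5U4_of_redM5U` (the inclusion of the landed class);
* **`typedCount_pinned_loop`** — the one rule the calculus lacked: a pinned-open LOOP off `F` (as
  contraction produces them) may be closed without changing the typed count
  (`typedCount_insert_pinned` + `typedCount_loop` + `typedCount_type_zero`);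
* **`redMeasure`** `= 3·|F| + #pinned-open + #pinned-open non-loops`, with the three descent
  lemmas `redMeasure_erase_update_lt` (a typed edge erased and re-pinned: loop, leaf, pendant,
  parallel, series), `redMeasure_contract_lt` (contraction of a pinned-open non-loop) and
  `redMeasure_update_closed_lt` (a pinned-open loop closed) — every rule strictly decreases it.

Own code; standard axioms; no `native_decide`.
-/

namespace Summit.Ventures.PercRepro2

open UnionCluster

namespace CovForm

namespace TypedRed

open Contract Untouched

/-! ## The four-mark base -/

section Base5U4

variable {V : Type*} {E : Type*} [Fintype E] [DecidableEq E]

/-- The base of the reduction calculus with the four vanishing rules: at most five typed edges, or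
the pinned cluster of one of `a₁`, `a₂`, `o`, `b` untouched by the typed edges. -/
def Base5U4 (ends : E → Sym2 V) (o a₁ a₂ _a₃ b : V) (F : Finset E) (z : Config E)
    (_τ : E → ℕ) : Prop :=
  F.card ≤ 5 ∨ UntouchedBy ends F z a₁ ∨ UntouchedBy ends F z a₂ ∨ UntouchedBy ends F z o ∨
    UntouchedBy ends F z b

variable {R : Type*} [Field R] [LinearOrder R] [IsStrictOrderedRing R]

/-- The typed count is nonnegative on the base `Base5U4` (`FiveTypedAll` for `|F| ≤ 5`; the
untouched-mark vanishing theorems otherwise). -/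
theorem typedCount_nonneg_of_base5U4 (ends : E → Sym2 V) (o a₁ a₂ a₃ b : V) (F : Finset E)
    (z : Config E) (τ : E → ℕ) (hB : Base5U4 ends o a₁ a₂ a₃ b F z τ)
    (hτ : ∀ e ∈ F, τ e = 1 ∨ τ e = 2) :
    0 ≤ typedCount F z τ (K3 ends o a₁ a₂ a₃ b : Config E → Config E → Config E → R) := by
  rcases hB with h5 | h1 | h2 | ho | hb
  · exact TwoTyped.typedCount_nonneg_of_card_le_five' ends o a₁ a₂ a₃ b F h5 z τ hτ
  · rw [typedCount_eq_zero_of_untouched_a1 ends o a₁ a₂ a₃ b F z τ hτ h1]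
  · rw [typedCount_eq_zero_of_untouched_a2 ends o a₁ a₂ a₃ b F z τ hτ h2]
  · rw [typedCount_eq_zero_of_untouched_o ends o a₁ a₂ a₃ b F z τ hτ ho]
  · rw [typedCount_eq_zero_of_untouched_b ends o a₁ a₂ a₃ b F z τ hτ hb]

end Base5U4

section RedM5U4

variable {V : Type*} {E : Type*} [DecidableEq V] [Fintype E] [DecidableEq E]

/-- **The reducible class with the four-mark base.** -/
abbrev RedM5U4 : (E → Sym2 V) → V → V → V → V → V → Finset E → Config E → (E → ℕ) → Prop :=
  RedMGen Base5U4

variable {R : Type*} [Field R] [LinearOrder R] [IsStrictOrderedRing R]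

/-- **Row 2′TRI on `RedM5U4`.** -/
theorem typedCount_nonneg_of_redM5U4 {ends : E → Sym2 V} {o a₁ a₂ a₃ b : V} {F : Finset E}
    {z : Config E} {τ : E → ℕ} (h : RedM5U4 ends o a₁ a₂ a₃ b F z τ)
    (hτ : ∀ e ∈ F, τ e = 1 ∨ τ e = 2) :
    0 ≤ typedCount F z τ (K3 ends o a₁ a₂ a₃ b : Config E → Config E → Config E → R) :=
  typedCount_nonneg_of_redMGen (fun ends o a₁ a₂ a₃ b F z τ hB hτ =>
    typedCount_nonneg_of_base5U4 ends o a₁ a₂ a₃ b F z τ hB hτ) h hτ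

omit [Fintype E] in
/-- `RedM5U ⊆ RedM5U4` (the same rules, a weaker base). -/
theorem redM5U4_of_redM5U {ends : E → Sym2 V} {o a₁ a₂ a₃ b : V} {F : Finset E} {z : Config E}
    {τ : E → ℕ} (h : RedM5U ends o a₁ a₂ a₃ b F z τ) : RedM5U4 ends o a₁ a₂ a₃ b F z τ := by
  induction h with
  | base ends o a₁ a₂ a₃ b F z τ hF =>
    refine RedMGen.base ends o a₁ a₂ a₃ b F z τ ?_
    rcases hF with h | h | h
    · exact Or.inl h
    · exact Or.inr (Or.inl h)
    · exact Or.inr (Or.inr (Or.inl h))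
  | @contract ends o a₁ a₂ a₃ b F z τ g u v hg hgF hz _ ih =>
    exact RedMGen.contract ends o a₁ a₂ a₃ b F z τ hg hgF hz ih
  | @rootPair ends o a₁ a₂ a₃ b F z τ f hf hfF =>
    exact RedMGen.rootPair ends o a₁ a₂ a₃ b F z τ hf hfF
  | @loop ends o a₁ a₂ a₃ b F z τ f u hf hfF _ ih =>
    exact RedMGen.loop ends o a₁ a₂ a₃ b F z τ hf hfF ih
  | @leaf ends o a₁ a₂ a₃ b F z τ f l u hf hlu hlo hl1 hl2 hl3 hlb hfF hcl _ ih =>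
    exact RedMGen.leaf ends o a₁ a₂ a₃ b F z τ hf hlu hlo hl1 hl2 hl3 hlb hfF hcl ih
  | @pendantB ends o a₁ a₂ a₃ b F z τ f u hf hbu hbo hb1 hb2 hb3 hfF hcl _ ih =>
    exact RedMGen.pendantB ends o a₁ a₂ a₃ b F z τ hf hbu hbo hb1 hb2 hb3 hfF hcl ih
  | @pendantO ends o a₁ a₂ a₃ b F z τ f u hf hou ho1 ho2 ho3 hob hfF hcl _ ih =>
    exact RedMGen.pendantO ends o a₁ a₂ a₃ b F z τ hf hou ho1 ho2 ho3 hob hfF hcl ih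
  | @parallel ends o a₁ a₂ a₃ b F z τ e f hef hpar heF hfF _ _ _ ih1 ih2 ih3 =>
    exact RedMGen.parallel ends o a₁ a₂ a₃ b F z τ hef hpar heF hfF ih1 ih2 ih3
  | @series ends o a₁ a₂ a₃ b F z τ e f hef u w v he hf hwu hwv hwo hw1 hw2 hw3 hwb heF hfF hcl
      _ _ _ ih0 ih1 ih2 =>
    exact RedMGen.series ends o a₁ a₂ a₃ b F z τ hef he hf hwu hwv hwo hw1 hw2 hw3 hwb heF hfF
      hcl ih0 ih1 ih2

end RedM5U4

/-! ## The missing rule: a pinned-open loop off `F` may be closed -/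

section PinnedLoop

variable {V : Type*} {E : Type*} [Fintype E] [DecidableEq E] {R : Type*} [Field R]

/-- **Pinned loop**: closing a pinned-open loop `g ∉ F` does not change the typed count (put `g`
into `F` with the pinned type `3`, apply the typed-loop rule, take it out with type `0`). -/
theorem typedCount_pinned_loop (ends : E → Sym2 V) (o a₁ a₂ a₃ b : V) {g : E} {u : V}
    (hg : ends g = s(u, u)) (F : Finset E) (hgF : g ∉ F) (z : Config E) (hz : z g = true)
    (τ : E → ℕ) :
    typedCount F z τ (K3 ends o a₁ a₂ a₃ b : Config E → Config E → Config E → R) =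
      typedCount F (Function.update z g false) τ (K3 ends o a₁ a₂ a₃ b) := by
  have h1 := typedCount_insert_pinned F g hgF z τ
    (K3 ends o a₁ a₂ a₃ b : Config E → Config E → Config E → R)
  rw [hz] at h1
  have h3 : (if true = true then 3 else 0) = 3 := rfl
  rw [h3] at h1
  rw [← h1, typedCount_loop ends o a₁ a₂ a₃ b hg (insert g F) (Finset.mem_insert_self g F) z,
    Function.update_self, Nat.choose_self, Nat.cast_one, one_mul, Function.update_idem,
    typedCount_type_zero (insert g F) g (Finset.mem_insert_self g F) z _
      (Function.update_self g 0 τ), Finset.erase_insert hgF]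
  exact typedCount_congr_τ F _ (fun e he => Function.update_of_ne (fun h : e = g => hgF (h ▸ he)) 0 τ) _

end PinnedLoop

/-! ## The reduction measure -/

section Measure

variable {V : Type*} {E : Type*} [DecidableEq V] [Fintype E] [DecidableEq E]

/-- The pinned-open edges off `F`. -/
def pinnedOpen (F : Finset E) (z : Config E) : Finset E :=
  Finset.univ.filter fun g => g ∉ F ∧ z g = true

/-- The pinned-open non-loop edges off `F`. -/
def pinnedOpenNonLoop (ends : E → Sym2 V) (F : Finset E) (z : Config E) : Finset E :=
  Finset.univ.filter fun g => g ∉ F ∧ z g = true ∧ ¬ (ends g).IsDiag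

/-- The reduction measure `3·|F| + #pinned-open + #pinned-open non-loops`: every rule of the
calculus strictly decreases it. -/
def redMeasure (ends : E → Sym2 V) (F : Finset E) (z : Config E) : ℕ :=
  3 * F.card + (pinnedOpen F z).card + (pinnedOpenNonLoop ends F z).card

omit [DecidableEq V] in
/-- Membership in the pinned-open edge set. -/
lemma mem_pinnedOpen {F : Finset E} {z : Config E} {g : E} :
    g ∈ pinnedOpen F z ↔ g ∉ F ∧ z g = true := by
  simp [pinnedOpen]

/-- Membership in the pinned-open non-loop edge set. -/
lemma mem_pinnedOpenNonLoop {ends : E → Sym2 V} {F : Finset E} {z : Config E} {g : E} :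
    g ∈ pinnedOpenNonLoop ends F z ↔ g ∉ F ∧ z g = true ∧ ¬ (ends g).IsDiag := by
  simp [pinnedOpenNonLoop]

/-- Erasing a typed edge and re-pinning it: the measure drops. -/
theorem redMeasure_erase_update_lt (ends : E → Sym2 V) {F : Finset E} {f : E} (hf : f ∈ F)
    (z : Config E) (c : Bool) :
    redMeasure ends (F.erase f) (Function.update z f c) < redMeasure ends F z := by
  have hpo : pinnedOpen (F.erase f) (Function.update z f c) ⊆ insert f (pinnedOpen F z) := by
    intro g hg
    rw [mem_pinnedOpen] at hg
    rw [Finset.mem_insert, mem_pinnedOpen]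
    by_cases hgf : g = f
    · exact Or.inl hgf
    · refine Or.inr ⟨fun hgF => hg.1 (Finset.mem_erase.2 ⟨hgf, hgF⟩), ?_⟩
      rw [Function.update_of_ne hgf] at hg
      exact hg.2
  have hnl : pinnedOpenNonLoop ends (F.erase f) (Function.update z f c) ⊆
      insert f (pinnedOpenNonLoop ends F z) := by
    intro g hg
    rw [mem_pinnedOpenNonLoop] at hg
    rw [Finset.mem_insert, mem_pinnedOpenNonLoop]
    by_cases hgf : g = f
    · exact Or.inl hgf
    · refine Or.inr ⟨fun hgF => hg.1 (Finset.mem_erase.2 ⟨hgf, hgF⟩), ?_, hg.2.2⟩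
      rw [Function.update_of_ne hgf] at hg
      exact hg.2.1
  have h1 := (Finset.card_le_card hpo).trans (Finset.card_insert_le f _)
  have h2 := (Finset.card_le_card hnl).trans (Finset.card_insert_le f _)
  have hc := Finset.card_erase_of_mem hf
  have hpos : 1 ≤ F.card := Finset.card_pos.2 ⟨f, hf⟩
  unfold redMeasure
  omega

/-- Contracting a pinned-open non-loop edge: the measure drops. -/
theorem redMeasure_contract_lt (ends : E → Sym2 V) {g : E} {u v : V} (hg : ends g = s(u, v))
    (huv : u ≠ v) {F : Finset E} (hgF : g ∉ F) {z : Config E} (hz : z g = true) :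
    redMeasure (contractEnds ends {u, v} u) F z < redMeasure ends F z := by
  have hsub : pinnedOpenNonLoop (contractEnds ends {u, v} u) F z ⊆ pinnedOpenNonLoop ends F z := by
    intro g' hg'
    rw [mem_pinnedOpenNonLoop] at hg' ⊢
    refine ⟨hg'.1, hg'.2.1, fun hd => hg'.2.2 ?_⟩
    rw [contractEnds_apply]
    exact hd.map
  have hss : pinnedOpenNonLoop (contractEnds ends {u, v} u) F z ⊂ pinnedOpenNonLoop ends F z := by
    rw [Finset.ssubset_iff_of_subset hsub]
    refine ⟨g, ?_, ?_⟩
    · rw [mem_pinnedOpenNonLoop]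
      refine ⟨hgF, hz, ?_⟩
      rw [hg, Sym2.mk_isDiag_iff]
      exact huv
    · rw [mem_pinnedOpenNonLoop]
      rintro ⟨-, -, hd⟩
      apply hd
      rw [contractEnds_apply, hg, Sym2.map_mk, Sym2.mk_isDiag_iff,
        contractMap_of_mem (Finset.mem_insert_self u {v}),
        contractMap_of_mem (Finset.mem_insert_of_mem (Finset.mem_singleton_self v))]
  have := Finset.card_lt_card hss
  unfold redMeasure
  omega

/-- Closing a pinned-open edge off `F`: the measure drops. -/
theorem redMeasure_update_closed_lt (ends : E → Sym2 V) {F : Finset E} {g : E} (hgF : g ∉ F)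
    {z : Config E} (hz : z g = true) :
    redMeasure ends F (Function.update z g false) < redMeasure ends F z := by
  have hsub : pinnedOpen F (Function.update z g false) ⊆ pinnedOpen F z := by
    intro g' hg'
    rw [mem_pinnedOpen] at hg' ⊢
    refine ⟨hg'.1, ?_⟩
    have hne : g' ≠ g := by
      rintro rfl
      rw [Function.update_self] at hg'
      exact Bool.false_ne_true hg'.2
    rw [Function.update_of_ne hne] at hg'
    exact hg'.2
  have hss : pinnedOpen F (Function.update z g false) ⊂ pinnedOpen F z := by
    rw [Finset.ssubset_iff_of_subset hsub]
    refine ⟨g, mem_pinnedOpen.2 ⟨hgF, hz⟩, ?_⟩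
    rw [mem_pinnedOpen, Function.update_self]
    rintro ⟨-, h⟩
    exact Bool.false_ne_true h
  have hsub' : pinnedOpenNonLoop ends F (Function.update z g false) ⊆
      pinnedOpenNonLoop ends F z := by
    intro g' hg'
    rw [mem_pinnedOpenNonLoop] at hg' ⊢
    refine ⟨hg'.1, ?_, hg'.2.2⟩
    have hne : g' ≠ g := by
      rintro rfl
      rw [Function.update_self] at hg'
      exact Bool.false_ne_true hg'.2.1
    rw [Function.update_of_ne hne] at hg'
    exact hg'.2.1
  have h1 := Finset.card_lt_card hss
  have h2 := Finset.card_le_card hsub'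
  unfold redMeasure
  omega

end Measure

end TypedRed

end CovForm

end Summit.Ventures.PercRepro2
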